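import Mathlib
import Summits.Ventures.PercRepro2.SwOutCrossBaseMonoDefs

/-!
# The cross base: red connection outside the structure is monotone in the type (blind cell
PercRepro2, night-4 g23, 2026-08-28; proofs/NIGHT4-G23.md §10, step (3), the red half)

Two points `x ≤ x'` of the cube in the restricted partition order — blue arms stay blue, red ports
(outside bits `false`) stay red ports, red links between red ports are kept — and `x` without
red-side leak. A red path of the realisation of `x` from a vertex `l` outside the structure to a
vertex `o` outside the structure, avoiding `h`, crosses the structure in segments: through one blue
arm (whose edges keep their colour at `x'`), or through the dropped vertices and `u` from a red
port to a red port (a walk of the link graph, hence a red link kept at `x'`). So `o` is red-reached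
from `l` at `x'` as well: `CrossBase.conn_mono`.
-/

namespace Summit.Ventures.PercRepro2

namespace CrossArm

open Hull LocRows

variable {V E : Type*}

open scoped Classical

section Mono

variable {ends : E → Sym2 V} {σ : Config E} {h u : V} {ι X κ : Type*} {U : ι → Set V}
  {p : X → V} {G : SimpleGraph X} {F : κ → Set V} (hb : CrossBase ends σ h u U p G F)
include hb

/-- **The step of a crossing segment**: the invariant propagates along a red edge of the
realisation of `x` into the structure. -/
theorem CrossBase.crossInv_step (hup : ∀ i, ∃ e, ends e = s(u, p i))
    (hcross : ∀ i j, G.Adj i j → ∃ e, ends e = s(p i, p j)) {x x' : PtXG ι κ X G}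
    (hxL : ¬ LeakRX G x) (harm : ∀ j, x.2.1 j = false → x'.2.1 j = false)
    (hfar : ∀ k, x.1 k = false → x'.1 k = false) {a : V} (ha : a ∉ strX h u U p F)
    (hah : ¬ Conn ends (crossReal ends u U p G F σ x) h a) {v z : V}
    (hinv : CrossInv ends σ u U p G F x x' a v)
    (hav : Conn ends (crossReal ends u U p G F σ x) a v)
    (hvz : (openGraph ends (crossReal ends u U p G F σ x)).Adj v z) (hz : z ∈ strX h u U p F) :
    CrossInv ends σ u U p G F x x' a z := by
  obtain ⟨hne, e, he, hends⟩ := exists_edge_of_adj hvz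
  have ha' := ha
  rw [notMem_strX_iff] at ha'
  rcases hinv with hva | ⟨j, hj, hv, hconn⟩ | ⟨k, hk, hv, hconn⟩ |
    ⟨i, hi, ⟨e₀, he₀⟩, ov, hvo, hreach⟩
  · -- the first step from `a`
    subst hva
    rcases hz with hzh | hzu | ⟨i, rfl⟩ | hz
    · rw [hzh] at hends
      rcases hb.h_edges e v (ends_swap hends) with ⟨j, hj⟩ | ⟨k, hk⟩
      · exact absurd (mem_armsAllX_of_U hj) ha'.2.2.2
      · exact absurd (mem_armsAllX_of_F hk) ha'.2.2.2
    · rw [hzu] at hends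
      rcases hb.u_edges e v (ends_swap hends) with ⟨j, hj⟩ | ⟨i, hi⟩
      · exact absurd (mem_armsAllX_of_U hj) ha'.2.2.2
      · exact absurd hi (ha'.2.2.1 i)
    · -- into a red port
      have hi : x.2.2.2.2 i = false :=
        hb.ext_eq_false_of_red (ends_swap hends) ha'.2.1 ha'.2.2.1 he
      exact Or.inr (Or.inr (Or.inr ⟨i, hi, ⟨e, hends⟩, some i, rfl, SimpleGraph.Reachable.refl _⟩))
    · rcases mem_armsAllX_iff.1 hz with ⟨j, hj⟩ | ⟨k, hk⟩
      · -- into a blue u-arm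
        have hj' : x.2.1 j = false := hb.arm_eq_false_of_red (ends_swap hends) hj ha he
        refine Or.inr (Or.inl ⟨j, hj', hj, SimpleGraph.Adj.reachable (adj_of_edge hne ?_ hends)⟩)
        rw [hb.crossReal_eq_U hj' (harm j hj') ⟨z, hj, v, ends_swap hends⟩]
        exact he
      · -- into a blue far arm
        have hk' : x.1 k = false := hb.far_eq_false_of_red (ends_swap hends) hk ha he
        refine Or.inr (Or.inr (Or.inl ⟨k, hk', hk,
          SimpleGraph.Adj.reachable (adj_of_edge hne ?_ hends)⟩))
        rw [hb.crossReal_eq_F hk' (hfar k hk') ⟨z, hk, v, ends_swap hends⟩]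
        exact he
  · -- inside a blue u-arm
    rcases hz with hzh | hzu | ⟨i, rfl⟩ | hz
    · rw [hzh] at hends
      have := hb.not_red_U_of_sigma_red ⟨v, hv, h, hends⟩ hj (hb.h_red e v (ends_swap hends))
      rw [this] at he
      exact absurd he (by decide)
    · rw [hzu] at hends
      have := hb.not_red_U_of_sigma_red ⟨v, hv, u, hends⟩ hj (hb.u_red e v (ends_swap hends))
      rw [this] at he
      exact absurd he (by decide)
    · rcases hb.p_edges i e v (ends_swap hends) with hvu | ⟨j', hvp, -⟩ | ⟨-, -, -, hvA⟩
      · exact absurd (hvu ▸ hv) (hb.u_notMem_U j)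
      · exact absurd (hvp ▸ hv) (hb.p_notMem_U j' j)
      · exact absurd (mem_armsAllX_of_U hv) hvA
    · rcases mem_armsAllX_iff.1 hz with ⟨j', hj'⟩ | ⟨k, hk⟩
      · by_cases hjj : j = j'
        · subst hjj
          refine Or.inr (Or.inl ⟨j, hj, hj', conn_trans hconn
            (SimpleGraph.Adj.reachable (adj_of_edge hne ?_ hends))⟩)
          rw [hb.crossReal_eq_U hj (harm j hj) ⟨v, hv, z, hends⟩]
          exact he
        · exact absurd hj' (fun hj' => hb.no_cross_UU j j' hjj e v z hends hv hj')
      · exact absurd hk (fun hk => hb.no_cross_UF j k e v z hends hv hk)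
  · -- inside a blue far arm
    rcases hz with hzh | hzu | ⟨i, rfl⟩ | hz
    · rw [hzh] at hends
      have := hb.not_red_F_of_sigma_red ⟨v, hv, h, hends⟩ hk (hb.h_red e v (ends_swap hends))
      rw [this] at he
      exact absurd he (by decide)
    · rw [hzu] at hends
      rcases hb.u_edges e v (ends_swap hends) with ⟨j, hj⟩ | ⟨i, hi⟩
      · exact absurd hv (hb.U_disj_F j k v hj)
      · exact absurd (hi ▸ hv) (hb.p_notMem_F i k)
    · rcases hb.p_edges i e v (ends_swap hends) with hvu | ⟨j', hvp, -⟩ | ⟨-, -, -, hvA⟩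
      · exact absurd (hvu ▸ hv) (hb.u_notMem_F k)
      · exact absurd (hvp ▸ hv) (hb.p_notMem_F j' k)
      · exact absurd (mem_armsAllX_of_F hv) hvA
    · rcases mem_armsAllX_iff.1 hz with ⟨j, hj⟩ | ⟨k', hk'⟩
      · exact absurd hv (fun hv => hb.no_cross_UF j k e z v (ends_swap hends) hj hv)
      · by_cases hkk : k = k'
        · subst hkk
          refine Or.inr (Or.inr (Or.inl ⟨k, hk, hk', conn_trans hconn
            (SimpleGraph.Adj.reachable (adj_of_edge hne ?_ hends))⟩))
          rw [hb.crossReal_eq_F hk (hfar k hk) ⟨v, hv, z, hends⟩]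
          exact he
        · exact absurd hk' (fun hk' => hb.no_cross_FF k k' hkk e v z hends hv hk')
  · -- along the link graph
    rcases ov with _ | m
    · -- `v = u`
      simp only [linkVert] at hvo
      subst v
      rcases hb.u_edges e z hends with ⟨j, hj⟩ | ⟨m, rfl⟩
      · by_cases hjr : x.2.1 j = true
        · -- a red u-arm lies in the red cluster of `h`
          exfalso
          have hzh : z ∈ cluster ends (crossReal ends u U p G F σ x) h := by
            rw [hb.cluster_crossReal hup hcross hxL]
            exact (mem_redSetX_U hb hj).2 hjr
          exact hah (conn_trans hzh (conn_symm (conn_trans hav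
            (SimpleGraph.Adj.reachable (adj_of_edge hne he hends)))))
        · rw [Bool.not_eq_true] at hjr
          have := hb.not_red_U_of_sigma_red ⟨z, hj, u, ends_swap hends⟩ hjr
            (hb.u_red e z hends)
          rw [this] at he
          exact absurd he (by decide)
      · have huP : x.2.2.1 m = true := hb.uP_eq_true_of_red hends he
        have hadj : (GlinkE G x.2.2).Adj none (some m) := huP
        exact Or.inr (Or.inr (Or.inr ⟨i, hi, ⟨e₀, he₀⟩, some m, rfl,
          hreach.trans hadj.reachable⟩))
    · -- `v = p m`
      simp only [linkVert] at hvo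
      subst v
      rcases hb.p_edges m e z hends with hzu | ⟨m', rfl, hadj⟩ | ⟨hzh, hzu, hzp, hzA⟩
      · subst hzu
        have huP : x.2.2.1 m = true := hb.uP_eq_true_of_red (ends_swap hends) he
        have hadj : (GlinkE G x.2.2).Adj (some m) none := huP
        exact Or.inr (Or.inr (Or.inr ⟨i, hi, ⟨e₀, he₀⟩, none, rfl,
          hreach.trans hadj.reachable⟩))
      · have hc : x.2.2.2.1 ⟨s(m, m'), G.mem_edgeSet.2 hadj⟩ = true := by
          rw [hb.crossReal_apply_C (show e ∈ clsCX ends p G ⟨s(m, m'), G.mem_edgeSet.2 hadj⟩ from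
            ⟨m, m', rfl, hends⟩), hb.cross_red m m' e hends] at he
          by_contra hc
          rw [if_neg hc] at he
          exact absurd he (by decide)
        have hadj' : (GlinkE G x.2.2).Adj (some m) (some m') := ⟨hadj, hc⟩
        exact Or.inr (Or.inr (Or.inr ⟨i, hi, ⟨e₀, he₀⟩, some m', rfl,
          hreach.trans hadj'.reachable⟩))
      · exact absurd hz ((notMem_strX_iff h u U p F).2 ⟨hzh, hzu, hzp, hzA⟩)

/-- **The exit of a crossing segment**: from a vertex satisfying the invariant, a red edge of the
realisation of `x` to a vertex outside the structure gives a red connection at `x'`. -/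
theorem CrossBase.conn_of_crossInv (hup : ∀ i, ∃ e, ends e = s(u, p i))
    (hcross : ∀ i j, G.Adj i j → ∃ e, ends e = s(p i, p j)) {x x' : PtXG ι κ X G}
    (harm : ∀ j, x.2.1 j = false → x'.2.1 j = false)
    (hfar : ∀ k, x.1 k = false → x'.1 k = false)
    (hext : ∀ i, x.2.2.2.2 i = false → x'.2.2.2.2 i = false)
    (hlink : ∀ i m, x.2.2.2.2 i = false → x.2.2.2.2 m = false → rlinkE G x.2.2 i m →
      rlinkE G x'.2.2 i m)
    {a : V} (ha : a ∉ strX h u U p F) {v b : V} (hinv : CrossInv ends σ u U p G F x x' a v)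
    (hvb : (openGraph ends (crossReal ends u U p G F σ x)).Adj v b) (hbO : b ∉ strX h u U p F) :
    Conn ends (crossReal ends u U p G F σ x') a b := by
  obtain ⟨hne, e, he, hends⟩ := exists_edge_of_adj hvb
  have ha' := ha
  rw [notMem_strX_iff] at ha'
  have hb' := hbO
  rw [notMem_strX_iff] at hb'
  rcases hinv with hva | ⟨j, hj, hv, hconn⟩ | ⟨k, hk, hv, hconn⟩ |
    ⟨i, hi, ⟨e₀, he₀⟩, ov, hvo, hreach⟩
  · subst hva
    refine SimpleGraph.Adj.reachable (adj_of_edge hne ?_ hends)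
    rw [hb.crossReal_apply_out hends ha hbO]
    rw [hb.crossReal_apply_out hends ha hbO] at he
    exact he
  · refine conn_trans hconn (SimpleGraph.Adj.reachable (adj_of_edge hne ?_ hends))
    rw [hb.crossReal_eq_U hj (harm j hj) ⟨v, hv, b, hends⟩]
    exact he
  · refine conn_trans hconn (SimpleGraph.Adj.reachable (adj_of_edge hne ?_ hends))
    rw [hb.crossReal_eq_F hk (hfar k hk) ⟨v, hv, b, hends⟩]
    exact he
  · rcases ov with _ | m
    · simp only [linkVert] at hvo
      subst v
      rcases hb.u_edges e b hends with ⟨j, hj⟩ | ⟨i', hi'⟩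
      · exact absurd (mem_armsAllX_of_U hj) hb'.2.2.2
      · exact absurd hi' (hb'.2.2.1 i')
    · simp only [linkVert] at hvo
      subst v
      rcases hb.p_edges m e b hends with hbu | ⟨j, hbp, -⟩ | ⟨-, hbu, hbp, -⟩
      · exact absurd hbu hb'.2.1
      · exact absurd hbp (hb'.2.2.1 j)
      · -- exit through the red port `p m`: the red link `i – m` is kept at `x'`
        have hm : x.2.2.2.2 m = false := hb.ext_eq_false_of_red hends hbu hbp he
        obtain ⟨w⟩ := hlink i m hi hm hreach
        have h1 : Conn ends (crossReal ends u U p G F σ x') a (p i) :=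
          SimpleGraph.Adj.reachable (adj_of_edge (ha'.2.2.1 i)
            (hb.ext_red_of_eq_false (ends_swap he₀) ha'.2.1 ha'.2.2.1 (hext i hi)) he₀)
        have h2 : Conn ends (crossReal ends u U p G F σ x') (p i) (p m) :=
          hb.conn_of_linkWalk hup hcross w
        have h3 : Conn ends (crossReal ends u U p G F σ x') (p m) b :=
          SimpleGraph.Adj.reachable (adj_of_edge hne
            (hb.ext_red_of_eq_false hends hbu hbp (hext m hm)) hends)
        exact conn_trans (conn_trans h1 h2) h3

/-- A crossing segment satisfies the invariant. -/
theorem CrossBase.crossInv_of_segX (hup : ∀ i, ∃ e, ends e = s(u, p i))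
    (hcross : ∀ i j, G.Adj i j → ∃ e, ends e = s(p i, p j)) {x x' : PtXG ι κ X G}
    (hxL : ¬ LeakRX G x) (harm : ∀ j, x.2.1 j = false → x'.2.1 j = false)
    (hfar : ∀ k, x.1 k = false → x'.1 k = false) {a : V} (ha : a ∉ strX h u U p F)
    (hah : ¬ Conn ends (crossReal ends u U p G F σ x) h a) {v : V}
    (hseg : SegX ends (crossReal ends u U p G F σ x) (strX h u U p F) a v) :
    CrossInv ends σ u U p G F x x' a v := by
  induction hseg with
  | refl => exact Or.inl rfl
  | tail hab hbc ih =>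
    exact hb.crossInv_step hup hcross hxL harm hfar ha hah ih (conn_of_segX hab) hbc.1 hbc.2

/-- **Red connection outside the structure is monotone in the type.** For `x ≤ x'` (blue arms
stay blue, red ports stay red ports, red links between red ports are kept), `x` without red-side
leak, and `l`, `o` outside the structure with `h` not red-reached from `l` at `x`: a red
connection `l – o` at `x` is a red connection at `x'`. -/
theorem CrossBase.conn_mono (hup : ∀ i, ∃ e, ends e = s(u, p i))
    (hcross : ∀ i j, G.Adj i j → ∃ e, ends e = s(p i, p j)) {x x' : PtXG ι κ X G}
    (hxL : ¬ LeakRX G x) (harm : ∀ j, x.2.1 j = false → x'.2.1 j = false)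
    (hfar : ∀ k, x.1 k = false → x'.1 k = false)
    (hext : ∀ i, x.2.2.2.2 i = false → x'.2.2.2.2 i = false)
    (hlink : ∀ i m, x.2.2.2.2 i = false → x.2.2.2.2 m = false → rlinkE G x.2.2 i m →
      rlinkE G x'.2.2 i m)
    {l o : V} (hl : l ∉ strX h u U p F) (ho : o ∉ strX h u U p F)
    (hlh : ¬ Conn ends (crossReal ends u U p G F σ x) l h)
    (hlo : Conn ends (crossReal ends u U p G F σ x) l o) :
    Conn ends (crossReal ends u U p G F σ x') l o := by
  have key : ∀ v, Conn ends (crossReal ends u U p G F σ x) l v →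
      (v ∉ strX h u U p F ∧ Conn ends (crossReal ends u U p G F σ x') l v) ∨
        ∃ a, a ∉ strX h u U p F ∧ Conn ends (crossReal ends u U p G F σ x') l a ∧
          Conn ends (crossReal ends u U p G F σ x) l a ∧
          SegX ends (crossReal ends u U p G F σ x) (strX h u U p F) a v := by
    intro v hv
    rw [Conn, SimpleGraph.reachable_iff_reflTransGen] at hv
    induction hv with
    | refl => exact Or.inl ⟨hl, conn_refl _ _ _⟩
    | @tail b c hab hbc ih =>
      by_cases hc : c ∈ strX h u U p F
      · rcases ih with ⟨hbO, hb'⟩ | ⟨a, haO, ha', hla, hseg⟩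
        · refine Or.inr ⟨b, hbO, hb', ?_, Relation.ReflTransGen.single ⟨hbc, hc⟩⟩
          rw [Conn, SimpleGraph.reachable_iff_reflTransGen]
          exact hab
        · exact Or.inr ⟨a, haO, ha', hla, hseg.tail ⟨hbc, hc⟩⟩
      · rcases ih with ⟨hbO, hb'⟩ | ⟨a, haO, ha', hla, hseg⟩
        · obtain ⟨hne, e, he, hends⟩ := exists_edge_of_adj hbc
          refine Or.inl ⟨hc, conn_trans hb' (SimpleGraph.Adj.reachable (adj_of_edge hne ?_ hends))⟩
          rw [hb.crossReal_apply_out hends hbO hc]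
          rw [hb.crossReal_apply_out hends hbO hc] at he
          exact he
        · have hah : ¬ Conn ends (crossReal ends u U p G F σ x) h a :=
            fun hha => hlh (conn_trans hla (conn_symm hha))
          have hinv := hb.crossInv_of_segX hup hcross hxL harm hfar haO hah hseg
          exact Or.inl ⟨hc, conn_trans ha'
            (hb.conn_of_crossInv hup hcross harm hfar hext hlink haO hinv hbc hc)⟩
  rcases key o hlo with ⟨-, ho'⟩ | ⟨a, -, ha', -, hseg⟩
  · exact ho'
  · rcases hseg.cases_tail with hoa | ⟨c, -, hco⟩
    · rw [hoa]
      exact ha'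
    · exact absurd hco.2 ho

end Mono

end CrossArm

end Summit.Ventures.PercRepro2
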